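import Summits.QuantumFields.BalabanUV.T4Continuum.Support.NE7CornerBumpFlatProjection
import Summits.QuantumFields.BalabanUV.T4Continuum.Support.NE7CornerBumpGram
import HarnessLib

/-!
# NE7CornerBumpFlatGalerkinSup — THE SUP LETTER OF THE GALERKIN RESIDUAL OF THE BUMP CLASS AT THE FLAT BACKGROUND, `M`-UNIFORM AND EXPLICIT:
# if `λ₁ ∈ T^ρ` makes `F + Δ_1λ₁ ⊥ Δ_1T^ρ` then `‖Δ_1λ₁‖_∞ ≤ (2 + 576·16^d·64^{2(d−1)})·‖F‖_∞` — the first sup bound of F90's `hGalR` at `W = 1`; file 32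

Cell `pub-balaban`, rung (B)+1 sub-cell t4, lineage `b2b-balaban-t4-ne7-p1` (CRUX PROVER NE7 #1 = OWNER of row NE7), generation 78; memo
`t4/b2b-balaban-t4-ne7-p1-g78/BUMP-CLASS-FLAT.md` §4.  File F101 (over F97 `NE7CornerBumpFlatProjection`, F99 `NE7CornerBumpGram`, F96, F95, row NE3's flat dictionary).
WHY (memo §4).  The residual `g := F + Δ_1λ₁` of the Galerkin projection of the bump class has `Δ_1g ⊥ T^ρ` (summation by parts), so F97's explicit projection gives
`Δ_1g = Φ_{LLρ}C₁ + Φ_ρC₂`.  Summing over the period kills `C₂` (`(Σρ)‖C₂(0)‖² = 0`); pairing with the single-corner bump `Φ_ρD` (`D = X` on the class of `w₀`, `0` else)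
and moving `Δ_1` across gives `(Σ_r ρ·LLρ)·C₁(w₀) = Σ_r Lρ(r)•F(M•w₀ + r − s)` (the `λ₁`-term dies by clause (i) for `λ₁ ∈ T^ρ`), where `Σ_r ρ·LLρ = Σ_r (Lρ)² = γ₁`
(blockwise summation by parts); then `g − Φ_{Lρ}C₁` is `Δ_1`-harmonic, hence the constant `mean F`.  So `‖g‖ ≤ ‖F‖(1 + M^d·Λ²∕γ₁)` with `Λ = 3dM²(M⁴∕16)^{d−1}`
(F96) and `γ₁ ≥ (M∕16)^d(d(M²∕8)(M⁴∕1024)^{d−1})²` (F99): `M^dΛ²∕γ₁ ≤ 576·16^d·64^{2(d−1)}` EXACTLY `M`-free.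
WHAT ([folklore]; 0 def, 0 sorry; profile∕shift∕class by equational hypotheses as in F96–F100).  §1 `sum_rho_mul_laplap` (`Σρ·LLρ = Σ(Lρ)²`), `ratio_const`
(`Λ²M^d = 576·16^d·64^{2(d−1)}·γ_low`); §2 **`galerkin_residual_sup_flatCfg_bump`**.
HONEST FRAMING (page 1): lattice linear algebra at the TRIVIAL background; the second sup bound (`‖λ₁‖`), the docking, the curved letters, (L1)′, α₁, (L2) are NOT here;
nothing of Bałaban's asserted; (APE) NOT proved; NOT ONE-STEP, NOT NE7; spine 0∕9; finite T⁴ rung (B)+1 — NOT infinite volume, NOT mass gap, NOT `BetaPertH`, NOT Clay.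
Continuum YM on T⁴ ⇐ BetaPertH ∧ nine spine estimates (0/9 proved); BetaPertH ⇐ (D1) ∧ (D4) ∧ CAP+tail; G-an2-4 gates asym, D1 and NE2/3/4.
-/

set_option autoImplicit false

open scoped BigOperators Matrix Matrix.Norms.L2Operator
open NormedSpace Finset

namespace Summit.QuantumFields.BalabanUV.T4Continuum.NE7CornerBumpFlatGalerkinSup

open Literature.MathematicalPhysics.QuantumFieldTheory.Balaban1983to89
open B7Prop1Explicit B7Prop2Explicit MatrixNorms
open T4AveragingDeficitWall (IsUnitaryCfg)
open T4AveragingDeficitWallBoundary (IsPeriodicCfg periodBox mem_periodBox card_periodBox)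
open MinimalActionWitness (flatCfg isPeriodicCfg_flatCfg)
open BlockAveragePushDirGauge (gaugeDir)
open SmoothRefineBlocks (blk res)
open NE3CovariantCalculus (hsR hsR_self hsR_add_left hsR_add_right hsR_sub_left hsR_sub_right hsR_sum_left hsR_sum_right)
open NE3FrameFreeDecompositionPrep (hsR_smul_left hsR_smul_right)
open NE3LandauOrbit (hsR_zero_left hsR_zero_right eq_zero_of_nhsNormSq_eq_zero)
open NE3FlatHessianCurl (isUnitaryCfg_flatCfg)
open NE3.PairLandauB8 (covLapSite)
open NE3.LandauProjectionB8 (covLapSite_add_period)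
open NE3.LandauCorrectionSupB8FlatUnit (sum_covLapSite_flatCfg_eq_zero norm_mean_le)
open NE3.FlatBlockHarmonicInverse (sum_hsR_covLapSite_comm)
open PeriodicChoice (apply_wrap_eq wrap_mem_periodBox)
open NE7PinnedLandauLettersOfLHCI (covLapSite_sub' covLapSite_add')
open NE7ProfileFieldFlat (profS_add_period profS_mem_skew norm_profS_le covLapSite_flatCfg_profS sum_hsR_profS sum_hsR_profS_profS)
open NE7CornerBumpFlatLHCI (rho_nonneg rho_boundaryFree rho_mid_pos corner_datum_class_zero covLapSite_flatCfg_const abs_lap_rho_le)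
open NE7CornerBumpFlatProjection (eq_smul_ediv_of_dvd eq_zero_of_mem_periodBox_of_dvd dvd_add_period_iff lapRho_boundaryFree sum_rho_pos
  covLapSite_flatCfg_mem_skew const_of_covLapSite_flatCfg_eq_zero bump_projection_flatCfg)
open NE7CornerBumpGram (gram_lapRho_lower)

noncomputable section

variable {d : ℕ} {n : Type*} [Fintype n] [DecidableEq n]

/-! ## §1 Two constants: `Σρ·LLρ = Σ(Lρ)²` and the `M`-free ratio -/

/-- **BLOCKWISE SUMMATION BY PARTS**: `Σ_{r∈[0,M)^d} ρ(r)·LLρ(r) = Σ_r (Lρ(r))²` — read off the field identity `⟨Φ_ρC, Δ_1Φ_{Lρ}C⟩ = ⟨Δ_1Φ_ρC, Φ_{Lρ}C⟩` with a constant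
non-zero datum `C`. [folklore] -/
theorem sum_rho_mul_laplap [Nonempty n] {M : ℕ} (hM : 8 ≤ M) {ψ : ℤ → ℝ}
    (hψ : ∀ t : ℤ, ψ t = if 2 ≤ t ∧ t ≤ (M : ℤ) - 2 then (((t : ℝ) - 2) * ((M : ℝ) - 2 - t)) ^ 2 else 0)
    {ρ : Site d → ℝ} (hρ : ∀ r, ρ r = ∏ i, ψ (r i)) (s : Site d)
    {Lρ : Site d → ℝ} (hLρ : Lρ = fun r => ∑ ν : Fin d, (2 * ρ r - ρ (r - e ν) - ρ (r + e ν)))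
    {LLρ : Site d → ℝ} (hLLρ : LLρ = fun r => ∑ ν : Fin d, (2 * Lρ r - Lρ (r - e ν) - Lρ (r + e ν))) :
    ∑ r ∈ periodBox (d := d) M, ρ r * LLρ r = ∑ r ∈ periodBox (d := d) M, Lρ r * Lρ r := by
  have hM1 : 1 ≤ M := by omega
  have hP : 1 ≤ 1 * M := by omega
  have hρbf : ∀ r : Site d, ρ r ≠ 0 → ∀ i, 1 ≤ r i ∧ r i ≤ (M : ℤ) - 2 := rho_boundaryFree hψ hρ
  have hLρbf : ∀ r : Site d, Lρ r ≠ 0 → ∀ i, 1 ≤ r i ∧ r i ≤ (M : ℤ) - 2 := fun r hr => by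
    subst hLρ; exact lapRho_boundaryFree hψ hρ r hr
  -- the constant datum `C = i·1` (skew, non-zero), `1`-periodic
  set X : Matrix n n ℂ := Complex.I • (1 : Matrix n n ℂ) with hX
  set C : Site d → Matrix n n ℂ := fun _ => X with hC
  have hCP : ∀ (w : Site d) (i : Fin d), C (w + ((1 : ℕ) : ℤ) • e i) = C w := fun _ _ => rfl
  have hΦP := profS_add_period hM1 (N := 1) s ρ (C := C) hCP
  have hΦLP := profS_add_period hM1 (N := 1) s Lρ (C := C) hCP
  have hΔρ : covLapSite (flatCfg (d := d) (n := n)) (fun x => ρ (res M (x + s)) • C (blk M (x + s))) = fun x => Lρ (res M (x + s)) • C (blk M (x + s)) :=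
    funext fun y => by rw [hLρ]; exact covLapSite_flatCfg_profS hM1 s hρbf C y
  have hΔLρ : covLapSite (flatCfg (d := d) (n := n)) (fun x => Lρ (res M (x + s)) • C (blk M (x + s))) = fun x => LLρ (res M (x + s)) • C (blk M (x + s)) :=
    funext fun y => by rw [hLLρ]; exact covLapSite_flatCfg_profS hM1 s hLρbf C y
  have e1 := sum_hsR_covLapSite_comm (n := n) hP (f := fun x => ρ (res M (x + s)) • C (blk M (x + s)))
    (g := fun x => Lρ (res M (x + s)) • C (blk M (x + s))) hΦP hΦLP
  rw [hΔρ, hΔLρ] at e1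
  have e2 := sum_hsR_profS_profS hM1 (le_refl 1) s ρ LLρ (C := C) (C' := C) hCP hCP
  have e3 := sum_hsR_profS_profS hM1 (le_refl 1) s Lρ Lρ (C := C) (C' := C) hCP hCP
  simp only at e2 e3
  rw [e2, e3] at e1
  -- `Σ_{w∈[0,1)^d} hsR X X = ‖X‖² ≠ 0`
  have hXX : ∑ w ∈ periodBox (d := d) 1, hsR (C w) (C w) = nhsNormSq X := by
    have h1 : periodBox (d := d) 1 = {0} := by
      ext w; simp only [Finset.mem_singleton]
      constructor
      · intro hw; funext i; have := mem_periodBox.mp hw i; simp only [Pi.zero_apply]; omega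
      · intro hw; subst hw; exact mem_periodBox.mpr fun i => ⟨le_rfl, by simp⟩
    rw [h1, Finset.sum_singleton, hC, hsR_self]
  rw [hXX] at e1
  have hX0 : nhsNormSq X ≠ 0 := by
    intro h0
    have hXz : X = 0 := eq_zero_of_nhsNormSq_eq_zero h0
    obtain ⟨i⟩ := ‹Nonempty n›
    have := congr_fun (congr_fun hXz i) i
    simp [hX] at this
  exact (mul_right_cancel₀ hX0 e1).symm

/-- **THE `M`-FREE RATIO**: `(3dM²(M⁴∕16)^{d−1})²·M^d = 576·16^d·64^{2(d−1)}·[(M∕16)^d(d(M²∕8)(M⁴∕1024)^{d−1})²]`. [folklore] -/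
theorem ratio_const (hd : 1 ≤ d) {M : ℕ} (hM : 1 ≤ M) :
    (3 * (d : ℝ) * (M : ℝ) ^ 2 * ((M : ℝ) ^ 4 / 16) ^ (d - 1)) ^ 2 * (M : ℝ) ^ d
      = 576 * (16 : ℝ) ^ d * (64 : ℝ) ^ (2 * (d - 1)) * (((M : ℝ) / 16) ^ d * ((d : ℝ) * ((M : ℝ) ^ 2 / 8 * ((M : ℝ) ^ 4 / 1024) ^ (d - 1))) ^ 2) := by
  obtain ⟨k, rfl⟩ : ∃ k, d = k + 1 := ⟨d - 1, by omega⟩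
  simp only [Nat.add_sub_cancel]
  have hM0 : (M : ℝ) ≠ 0 := by exact_mod_cast (by omega : M ≠ 0)
  have h1 : (64 : ℝ) ^ (2 * k) * ((M : ℝ) ^ 4 / 1024) ^ (2 * k) = ((M : ℝ) ^ 4 / 16) ^ (2 * k) := by
    rw [← mul_pow]; congr 1; field_simp; norm_num
  have h2 : (16 : ℝ) ^ (k + 1) * ((M : ℝ) / 16) ^ (k + 1) = (M : ℝ) ^ (k + 1) := by
    rw [← mul_pow]; congr 1; field_simp
  have h3 : ((M : ℝ) ^ 4 / 16) ^ (2 * k) = (((M : ℝ) ^ 4 / 16) ^ k) ^ 2 := by rw [mul_comm, pow_mul]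
  have h4 : ((M : ℝ) ^ 4 / 1024) ^ (2 * k) = (((M : ℝ) ^ 4 / 1024) ^ k) ^ 2 := by rw [mul_comm, pow_mul]
  calc (3 * ((k + 1 : ℕ) : ℝ) * (M : ℝ) ^ 2 * ((M : ℝ) ^ 4 / 16) ^ k) ^ 2 * (M : ℝ) ^ (k + 1)
      = 9 * ((k + 1 : ℕ) : ℝ) ^ 2 * (M : ℝ) ^ 4 * (((M : ℝ) ^ 4 / 16) ^ k) ^ 2 * (M : ℝ) ^ (k + 1) := by ring
    _ = 9 * ((k + 1 : ℕ) : ℝ) ^ 2 * (M : ℝ) ^ 4 * ((64 : ℝ) ^ (2 * k) * (((M : ℝ) ^ 4 / 1024) ^ k) ^ 2)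
          * ((16 : ℝ) ^ (k + 1) * ((M : ℝ) / 16) ^ (k + 1)) := by rw [← h4, h1, h3, h2]
    _ = _ := by ring

/-! ## §2 The sup letter of the Galerkin residual -/

/-- **THE SUP LETTER OF THE GALERKIN RESIDUAL OF THE BUMP CLASS AT THE FLAT BACKGROUND**: for skew `(N·M)`-periodic `F` with `‖F‖_∞ ≤ B` and `λ₁` skew periodic in the
bump class with `Σ hsR (F + Δ_1λ₁)(Δ_1ν) = 0` for all skew periodic `ν ∈ T^ρ`: `‖Δ_1λ₁ y‖ ≤ (2 + 576·16^d·64^{2(d−1)})·B` (`M ≥ 8`, `N ≥ 1`, `d ≥ 1`). [folklore] -/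
theorem galerkin_residual_sup_flatCfg_bump [Nonempty n] (hd : 1 ≤ d) {M N : ℕ} (hM : 8 ≤ M) (hN : 1 ≤ N) {ψ : ℤ → ℝ}
    (hψ : ∀ t : ℤ, ψ t = if 2 ≤ t ∧ t ≤ (M : ℤ) - 2 then (((t : ℝ) - 2) * ((M : ℝ) - 2 - t)) ^ 2 else 0)
    {ρ : Site d → ℝ} (hρ : ∀ r, ρ r = ∏ i, ψ (r i)) {s : Site d} (hs : s = fun _ => ((M / 2 : ℕ) : ℤ))
    (T : (Site d → Matrix n n ℂ) → Prop)
    (hT : ∀ nu : Site d → Matrix n n ℂ, T nu ↔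
      ((∀ C : Site d → Matrix n n ℂ, (∀ w, C w ∈ skewAdjoint (Matrix n n ℂ)) → (∀ (w : Site d) (i : Fin d), C (w + (N : ℤ) • e i) = C w) →
          (∀ w : Site d, C ((N : ℤ) • w) = 0) →
          ∑ y ∈ periodBox (d := d) (N * M), hsR ((fun x => ρ (res M (x + s)) • C (blk M (x + s))) y)
            (covLapSite (flatCfg (d := d) (n := n)) (covLapSite (flatCfg (d := d) (n := n)) nu) y) = 0) ∧
       (∀ C : Site d → Matrix n n ℂ, (∀ w, C w ∈ skewAdjoint (Matrix n n ℂ)) → (∀ (w : Site d) (i : Fin d), C (w + (N : ℤ) • e i) = C w) →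
          (∀ w : Site d, (¬ ∀ i, (N : ℤ) ∣ w i) → C w = 0) →
          ∑ y ∈ periodBox (d := d) (N * M), hsR ((fun x => ρ (res M (x + s)) • C (blk M (x + s))) y) (nu y) = 0)))
    {F : Site d → Matrix n n ℂ} (hFs : ∀ y, F y ∈ skewAdjoint (Matrix n n ℂ)) (hFP : ∀ (y : Site d) (i : Fin d), F (y + ((N * M : ℕ) : ℤ) • e i) = F y)
    {B : ℝ} (hB : ∀ y, ‖F y‖ ≤ B)
    {lam₁ : Site d → Matrix n n ℂ} (hls : ∀ y, lam₁ y ∈ skewAdjoint (Matrix n n ℂ))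
    (hlP : ∀ (y : Site d) (i : Fin d), lam₁ (y + ((N * M : ℕ) : ℤ) • e i) = lam₁ y) (hlT : T lam₁)
    (horth : ∀ nu : Site d → Matrix n n ℂ, (∀ y, nu y ∈ skewAdjoint (Matrix n n ℂ)) →
        (∀ (y : Site d) (i : Fin d), nu (y + ((N * M : ℕ) : ℤ) • e i) = nu y) → T nu →
      ∑ y ∈ periodBox (d := d) (N * M), hsR (F y + covLapSite (flatCfg (d := d) (n := n)) lam₁ y) (covLapSite (flatCfg (d := d) (n := n)) nu y) = 0) :
    ∀ y, ‖covLapSite (flatCfg (d := d) (n := n)) lam₁ y‖ ≤ (2 + 576 * (16 : ℝ) ^ d * (64 : ℝ) ^ (2 * (d - 1))) * B := by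
  classical
  have hM1 : 1 ≤ M := by omega
  have hP : 1 ≤ N * M := Nat.mul_pos (by omega) (by omega)
  have hWP : IsPeriodicCfg (flatCfg (d := d) (n := n)) ((N * M : ℕ) : ℤ) := isPeriodicCfg_flatCfg _
  have hB0 : 0 ≤ B := (norm_nonneg _).trans (hB 0)
  set Δ : (Site d → Matrix n n ℂ) → Site d → Matrix n n ℂ := covLapSite (flatCfg (d := d) (n := n)) with hΔ
  set Lρ : Site d → ℝ := fun r => ∑ ν : Fin d, (2 * ρ r - ρ (r - e ν) - ρ (r + e ν)) with hLρ
  set LLρ : Site d → ℝ := fun r => ∑ ν : Fin d, (2 * Lρ r - Lρ (r - e ν) - Lρ (r + e ν)) with hLLρ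
  have hρbf : ∀ r : Site d, ρ r ≠ 0 → ∀ i, 1 ≤ r i ∧ r i ≤ (M : ℤ) - 2 := rho_boundaryFree hψ hρ
  have hLρbf : ∀ r : Site d, Lρ r ≠ 0 → ∀ i, 1 ≤ r i ∧ r i ≤ (M : ℤ) - 2 := fun r hr => lapRho_boundaryFree hψ hρ r hr
  have hperΔ : ∀ {g : Site d → Matrix n n ℂ}, (∀ (y : Site d) (i : Fin d), g (y + ((N * M : ℕ) : ℤ) • e i) = g y) →
      ∀ (y : Site d) (i : Fin d), Δ g (y + ((N * M : ℕ) : ℤ) • e i) = Δ g y := fun hg => covLapSite_add_period hWP hg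
  have hperΦ : ∀ (g : Site d → ℝ) {C : Site d → Matrix n n ℂ}, (∀ (w : Site d) (i : Fin d), C (w + (N : ℤ) • e i) = C w) →
      ∀ (y : Site d) (i : Fin d), (fun x => g (res M (x + s)) • C (blk M (x + s))) (y + ((N * M : ℕ) : ℤ) • e i)
        = (fun x => g (res M (x + s)) • C (blk M (x + s))) y := fun g C hC => profS_add_period hM1 s g hC
  have hΔρ : ∀ C : Site d → Matrix n n ℂ, Δ (fun x => ρ (res M (x + s)) • C (blk M (x + s))) = fun x => Lρ (res M (x + s)) • C (blk M (x + s)) :=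
    fun C => funext fun y => covLapSite_flatCfg_profS hM1 s hρbf C y
  have hΔLρ : ∀ C : Site d → Matrix n n ℂ, Δ (fun x => Lρ (res M (x + s)) • C (blk M (x + s))) = fun x => LLρ (res M (x + s)) • C (blk M (x + s)) :=
    fun C => funext fun y => covLapSite_flatCfg_profS hM1 s hLρbf C y
  -- the residual `g`, its Laplacian `f`, and F97's projection of `f`
  set g : Site d → Matrix n n ℂ := fun y => F y + Δ lam₁ y with hg
  have hΔlP := hperΔ hlP
  have hgP : ∀ (y : Site d) (i : Fin d), g (y + ((N * M : ℕ) : ℤ) • e i) = g y := fun y i => by simp only [hg, hFP y i, hΔlP y i]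
  have hgs : ∀ y, g y ∈ skewAdjoint (Matrix n n ℂ) := fun y => (skewAdjoint _).add_mem (hFs y) (covLapSite_flatCfg_mem_skew hls y)
  set f : Site d → Matrix n n ℂ := Δ g with hf
  have hfP : ∀ (y : Site d) (i : Fin d), f (y + ((N * M : ℕ) : ℤ) • e i) = f y := hperΔ hgP
  have hfs : ∀ y, f y ∈ skewAdjoint (Matrix n n ℂ) := covLapSite_flatCfg_mem_skew hgs
  have hforth : ∀ nu : Site d → Matrix n n ℂ, (∀ y, nu y ∈ skewAdjoint (Matrix n n ℂ)) →
      (∀ (y : Site d) (i : Fin d), nu (y + ((N * M : ℕ) : ℤ) • e i) = nu y) → T nu →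
      ∑ y ∈ periodBox (d := d) (N * M), hsR (f y) (nu y) = 0 := by
    intro nu hnus hnuP hnuT
    rw [hf, sum_hsR_covLapSite_comm hP hgP hnuP]
    exact horth nu hnus hnuP hnuT
  obtain ⟨C₁, C₂, hC₁s, hC₁P, hC₁0, hC₂s, hC₂P, hC₂0, hdec, hC₁f, -⟩ :=
    bump_projection_flatCfg hM hN hψ hρ hs hLρ hLLρ T hT hfs hfP hforth
  set Φ₁ : Site d → Matrix n n ℂ := fun x => LLρ (res M (x + s)) • C₁ (blk M (x + s)) with hΦ₁
  set Φ₂ : Site d → Matrix n n ℂ := fun x => ρ (res M (x + s)) • C₂ (blk M (x + s)) with hΦ₂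
  set Φρ₁ : Site d → Matrix n n ℂ := fun x => ρ (res M (x + s)) • C₁ (blk M (x + s)) with hΦρ₁
  set ΦL₁ : Site d → Matrix n n ℂ := fun x => Lρ (res M (x + s)) • C₁ (blk M (x + s)) with hΦL₁
  have hfk : ∀ y, f y = Φ₁ y + Φ₂ y := fun y => by simpa only [hΦ₁, hΦ₂] using hdec y
  have hΦρ₁P : ∀ (y : Site d) (i : Fin d), Φρ₁ (y + ((N * M : ℕ) : ℤ) • e i) = Φρ₁ y := hperΦ ρ hC₁P
  have hΦL₁P : ∀ (y : Site d) (i : Fin d), ΦL₁ (y + ((N * M : ℕ) : ℤ) • e i) = ΦL₁ y := hperΦ Lρ hC₁P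
  have hΦ₁eq : Φ₁ = Δ (Δ Φρ₁) := by rw [hΔρ C₁, hΔLρ C₁]
  have hΦL₁eq : ΦL₁ = Δ Φρ₁ := by rw [hΔρ C₁]
  -- (1) `C₂ = 0` (sum over the period)
  have hC₂all : ∀ w, C₂ w = 0 := by
    have hC₂zero : C₂ 0 = 0 := by
      set X : Matrix n n ℂ := C₂ 0 with hX
      have hconstP : ∀ (y : Site d) (i : Fin d), (fun _ : Site d => X) (y + ((N * M : ℕ) : ℤ) • e i) = (fun _ : Site d => X) y := fun _ _ => rfl
      have h1 : ∑ y ∈ periodBox (d := d) (N * M), hsR (Φ₂ y) X = (∑ r ∈ periodBox (d := d) M, ρ r) * nhsNormSq X := by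
        have e := sum_hsR_profS hM1 hN s ρ C₂ (F := fun _ : Site d => X) hconstP hC₂P
        simp only at e
        rw [hΦ₂]; simp only; rw [e]
        have hin : ∀ w ∈ periodBox (d := d) N, hsR (C₂ w) (∑ r ∈ periodBox (d := d) M, ρ r • X)
            = if w = 0 then (∑ r ∈ periodBox (d := d) M, ρ r) * nhsNormSq X else 0 := by
          intro w hw
          split_ifs with h0
          · rw [h0, ← Finset.sum_smul, hsR_smul_right, ← hX, hsR_self]
          · have hw' : ¬ ∀ i, (N : ℤ) ∣ w i := fun hd' => h0 (eq_zero_of_mem_periodBox_of_dvd hw hd')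
            rw [hC₂0 w hw', hsR_zero_left]
        rw [Finset.sum_congr rfl hin, Finset.sum_ite_eq' (periodBox (d := d) N) (0 : Site d), if_pos]
        exact mem_periodBox.mpr fun _ => ⟨le_rfl, by simp only [Pi.zero_apply]; exact_mod_cast (by omega : 0 < N)⟩
      have h2 : ∑ y ∈ periodBox (d := d) (N * M), hsR (Φ₂ y) X = 0 := by
        have e : ∀ y, Φ₂ y = f y - Φ₁ y := fun y => by rw [hfk y]; abel
        simp_rw [e, hsR_sub_left]
        rw [Finset.sum_sub_distrib, ← hsR_sum_left, ← hsR_sum_left]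
        have hz1 : ∑ y ∈ periodBox (d := d) (N * M), f y = 0 := by rw [hf]; exact sum_covLapSite_flatCfg_eq_zero hP hgP
        have hz2 : ∑ y ∈ periodBox (d := d) (N * M), Φ₁ y = 0 := by
          rw [hΦ₁eq]; exact sum_covLapSite_flatCfg_eq_zero hP (hperΔ hΦρ₁P)
        rw [hz1, hz2, hsR_zero_left, sub_zero]
      have h3 : (∑ r ∈ periodBox (d := d) M, ρ r) * nhsNormSq X = 0 := by rw [← h1, h2]
      rcases mul_eq_zero.mp h3 with h4 | h4
      · exact absurd h4 (sum_rho_pos hM hψ hρ).ne'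
      · exact eq_zero_of_nhsNormSq_eq_zero h4
    intro w
    by_cases hw : ∀ i, (N : ℤ) ∣ w i
    · rw [eq_smul_ediv_of_dvd hw, corner_datum_class_zero hC₂P, hC₂zero]
    · exact hC₂0 w hw
  have hΦ₂zero : ∀ y, Φ₂ y = 0 := fun y => by simp only [hΦ₂, hC₂all, smul_zero]
  -- (2) `h := g − Φ_{Lρ}C₁` is `Δ_1`-harmonic, hence the constant `mean F`
  set h : Site d → Matrix n n ℂ := fun y => g y - ΦL₁ y with hh
  have hhP : ∀ (y : Site d) (i : Fin d), h (y + ((N * M : ℕ) : ℤ) • e i) = h y := fun y i => by simp only [hh, hgP y i, hΦL₁P y i]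
  have hΔh0 : ∀ y, Δ h y = 0 := by
    intro y
    have e3 : Δ (fun y => g y - ΦL₁ y) y = Δ g y - Δ ΦL₁ y := covLapSite_sub' _ g ΦL₁ y
    rw [e3]
    have e4 : Δ ΦL₁ y = Φ₁ y := by rw [hΦL₁eq, hΦ₁eq]
    rw [e4, ← hf, hfk y, hΦ₂zero y, add_zero, sub_self]
  have hconst : ∀ v, h v = h 0 := const_of_covLapSite_flatCfg_eq_zero hP hhP hΔh0
  have hK : ‖h 0‖ ≤ B := by
    have hsum : ∑ y ∈ periodBox (d := d) (N * M), h y = ((((N * M : ℕ) : ℝ)) ^ d) • h 0 := by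
      rw [Finset.sum_congr rfl fun y _ => hconst y, Finset.sum_const, card_periodBox, ← Nat.cast_smul_eq_nsmul ℝ]
      push_cast; ring_nf
    have hsum2 : ∑ y ∈ periodBox (d := d) (N * M), h y = ∑ y ∈ periodBox (d := d) (N * M), F y := by
      have hz1 : ∑ y ∈ periodBox (d := d) (N * M), Δ lam₁ y = 0 := sum_covLapSite_flatCfg_eq_zero hP hlP
      have hz2 : ∑ y ∈ periodBox (d := d) (N * M), ΦL₁ y = 0 := by
        rw [hΦL₁eq]; exact sum_covLapSite_flatCfg_eq_zero hP hΦρ₁P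
      simp only [hh, hg, Finset.sum_sub_distrib, Finset.sum_add_distrib, hz1, hz2, add_zero, sub_zero]
    have hPd : (0 : ℝ) < (((N * M : ℕ) : ℝ)) ^ d := by positivity
    have e : h 0 = ((((N * M : ℕ) : ℝ)) ^ d)⁻¹ • ∑ y ∈ periodBox (d := d) (N * M), F y := by
      rw [← hsum2, hsum, smul_smul, inv_mul_cancel₀ hPd.ne', one_smul]
    rw [e]; exact norm_mean_le hP F hB
  -- (3) the block formula for `C₁` against `F`: `γ₁•C₁(w₀) = Σ_r Lρ(r)•F(M•w₀ + r − s)`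
  set γ₁ : ℝ := ∑ r ∈ periodBox (d := d) M, Lρ r * Lρ r with hγ₁
  have hγρ : ∑ r ∈ periodBox (d := d) M, ρ r * LLρ r = γ₁ := sum_rho_mul_laplap (n := n) hM hψ hρ s hLρ hLLρ
  set SF : Site d → Matrix n n ℂ := fun w => ∑ r ∈ periodBox (d := d) M, Lρ r • F ((M : ℤ) • w + r - s) with hSF
  have hFP' : ∀ (y : Site d) (i : Fin d), F (y + ((M : ℤ) * (N : ℤ)) • e i) = F y := fun y i => by
    have := hFP y i; push_cast at this; rw [mul_comm] at this; exact this
  have hSFP : ∀ (w : Site d) (i : Fin d), SF (w + (N : ℤ) • e i) = SF w := by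
    intro w i
    refine Finset.sum_congr rfl fun r _ => ?_
    have e1 : (M : ℤ) • (w + (N : ℤ) • e i) + r - s = ((M : ℤ) • w + r - s) + ((M : ℤ) * (N : ℤ)) • e i := by
      rw [smul_add, smul_smul]; abel
    rw [e1, hFP']
  have hC₁F : ∀ w₀ : Site d, γ₁ • C₁ w₀ = if (∀ i, (N : ℤ) ∣ w₀ i) then 0 else SF w₀ := by
    intro w₀
    split_ifs with hw₀
    · rw [eq_smul_ediv_of_dvd hw₀, hC₁0, smul_zero]
    · -- the single-corner datum `D` on the class of `w₀`
      have key : ∀ X : Matrix n n ℂ, X ∈ skewAdjoint (Matrix n n ℂ) → γ₁ * hsR X (C₁ w₀) = hsR X (SF w₀) := by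
        intro X hXs
        set D : Site d → Matrix n n ℂ := fun w => if (∀ i, (N : ℤ) ∣ (w - w₀) i) then X else 0 with hD
        have hDs : ∀ w, D w ∈ skewAdjoint (Matrix n n ℂ) := fun w => by
          simp only [hD]; split_ifs
          · exact hXs
          · exact (skewAdjoint _).zero_mem
        have hDP : ∀ (w : Site d) (i : Fin d), D (w + (N : ℤ) • e i) = D w := fun w i => by
          have e1 : w + (N : ℤ) • e i - w₀ = (w - w₀) + (N : ℤ) • e i := by abel
          simp only [hD, e1, dvd_add_period_iff (w - w₀) i]
        have hD0 : ∀ w : Site d, D ((N : ℤ) • w) = 0 := fun w => by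
          simp only [hD]
          rw [if_neg]
          intro hall
          exact hw₀ fun i => by
            have h1 := hall i
            simp only [Pi.sub_apply, Pi.smul_apply, smul_eq_mul] at h1
            have h2 : (N : ℤ) ∣ (N : ℤ) * w i := dvd_mul_right _ _
            have := (dvd_sub h2 h1); simpa using this
        -- the representative of the class of `w₀` in the period box
        set w₁ : Site d := fun i => w₀ i % (N : ℤ) with hw₁
        have hw₁mem : w₁ ∈ periodBox (d := d) N := wrap_mem_periodBox N hN w₀
        have hDw₁ : D w₁ = X := by
          simp only [hD]; rw [if_pos]; intro i
          simp only [hw₁, Pi.sub_apply]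
          have e1 : w₀ i % (N : ℤ) - w₀ i = (N : ℤ) * (-(w₀ i / (N : ℤ))) := by rw [Int.emod_def]; ring
          exact ⟨_, e1⟩
        have hDoff : ∀ w ∈ periodBox (d := d) N, w ≠ w₁ → D w = 0 := by
          intro w hw hne
          simp only [hD]; rw [if_neg]; intro hall
          apply hne; funext i
          obtain ⟨h0, h1⟩ := mem_periodBox.mp hw i
          have hdi : (N : ℤ) ∣ w i - w₀ i := by have := hall i; simpa only [Pi.sub_apply] using this
          have hmod : w₀ i % (N : ℤ) = w i % (N : ℤ) := Int.modEq_iff_dvd.mpr hdi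
          show w i = w₀ i % (N : ℤ)
          rw [hmod, Int.emod_eq_of_lt h0 h1]
        have hsumD : ∀ G : Site d → Matrix n n ℂ, (∀ (w : Site d) (i : Fin d), G (w + (N : ℤ) • e i) = G w) →
            ∑ w ∈ periodBox (d := d) N, hsR (D w) (G w) = hsR X (G w₀) := by
          intro G hGP
          rw [← Finset.sum_erase_add _ _ hw₁mem, Finset.sum_eq_zero fun w hw => by
            rw [hDoff w (Finset.mem_of_mem_erase hw) (Finset.ne_of_mem_erase hw), hsR_zero_left], zero_add, hDw₁]
          rw [show G w₁ = G w₀ from apply_wrap_eq hGP w₀]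
        -- WAY 1: through the decomposition `f = Φ_{LLρ}C₁`
        have hΦDP := hperΦ ρ hDP
        have way1 : ∑ y ∈ periodBox (d := d) (N * M), hsR ((fun x => ρ (res M (x + s)) • D (blk M (x + s))) y) (f y) = γ₁ * hsR X (C₁ w₀) := by
          rw [Finset.sum_congr rfl fun y _ => by rw [hfk y, hΦ₂zero y, add_zero]]
          have e := sum_hsR_profS_profS hM1 hN s ρ LLρ (C := D) (C' := C₁) hDP hC₁P
          simp only at e
          rw [hΦ₁]; simp only; rw [e, hγρ, hsumD C₁ hC₁P]
        -- WAY 2: through `f = Δ(F + Δλ₁)`: the `λ₁`-term dies by clause (i)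
        have way2 : ∑ y ∈ periodBox (d := d) (N * M), hsR ((fun x => ρ (res M (x + s)) • D (blk M (x + s))) y) (f y) = hsR X (SF w₀) := by
          have hΔρ' := hΔρ D
          have hΔLρ' := hΔLρ D
          simp only [hΔ] at hΔρ' hΔLρ'
          simp only [hf, hΔ]
          rw [← sum_hsR_covLapSite_comm hP (f := fun x => ρ (res M (x + s)) • D (blk M (x + s))) (g := g) hΦDP hgP, hΔρ']
          simp only [hg, hΔ, hsR_add_right, Finset.sum_add_distrib]
          -- the `F`-term
          have eF := sum_hsR_profS hM1 hN s Lρ D hFP hDP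
          have eF' : ∑ y ∈ periodBox (d := d) (N * M), hsR (Lρ (res M (y + s)) • D (blk M (y + s))) (F y)
              = ∑ w ∈ periodBox (d := d) N, hsR (D w) (SF w) := by simpa only [hSF] using eF
          rw [eF', hsumD SF hSFP]
          -- the `λ₁`-term
          have e0 : ∑ y ∈ periodBox (d := d) (N * M), hsR (Lρ (res M (y + s)) • D (blk M (y + s))) (covLapSite (flatCfg (d := d) (n := n)) lam₁ y) = 0 := by
            have h1 := ((hT lam₁).mp hlT).1 D hDs hDP hD0
            rw [← sum_hsR_covLapSite_comm hP (f := fun x => ρ (res M (x + s)) • D (blk M (x + s)))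
              (g := covLapSite (flatCfg (d := d) (n := n)) lam₁) hΦDP hΔlP, hΔρ'] at h1
            simpa only using h1
          rw [e0, add_zero]
        rw [← way1, way2]
      -- conclude with `X := γ₁•C₁ w₀ − SF w₀`
      have hSFs : SF w₀ ∈ skewAdjoint (Matrix n n ℂ) := (skewAdjoint _).sum_mem fun r _ => skewAdjoint.smul_mem _ (hFs _)
      set X : Matrix n n ℂ := γ₁ • C₁ w₀ - SF w₀ with hX
      have hXs : X ∈ skewAdjoint (Matrix n n ℂ) := (skewAdjoint _).sub_mem (skewAdjoint.smul_mem _ (hC₁s _)) hSFs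
      have h0 : hsR X X = 0 := by
        have := key X hXs
        rw [hX, hsR_sub_right, hsR_smul_right, sub_eq_zero]; exact this
      rw [hsR_self] at h0
      exact sub_eq_zero.mp (eq_zero_of_nhsNormSq_eq_zero h0)
  -- (4) sizes: `|Lρ| ≤ Λ`, `‖SF‖ ≤ M^d Λ B`, `γ₁ ≥ γ_low > 0`, `‖C₁‖ ≤ M^dΛB∕γ₁`
  set Λ : ℝ := 3 * (d : ℝ) * (M : ℝ) ^ 2 * ((M : ℝ) ^ 4 / 16) ^ (d - 1) with hΛ
  have hLρΛ : ∀ r, |Lρ r| ≤ Λ := fun r => abs_lap_rho_le hM hψ hρ r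
  have hSFle : ∀ w, ‖SF w‖ ≤ (M : ℝ) ^ d * Λ * B := by
    intro w
    calc ‖SF w‖ ≤ ∑ r ∈ periodBox (d := d) M, ‖Lρ r • F ((M : ℤ) • w + r - s)‖ := norm_sum_le _ _
      _ ≤ ∑ _r ∈ periodBox (d := d) M, Λ * B := Finset.sum_le_sum fun r _ => by
          rw [norm_smul, Real.norm_eq_abs]; exact mul_le_mul (hLρΛ r) (hB _) (norm_nonneg _) ((abs_nonneg _).trans (hLρΛ r))
      _ = (M : ℝ) ^ d * Λ * B := by rw [Finset.sum_const, card_periodBox, nsmul_eq_mul]; push_cast; ring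
  set γlow : ℝ := ((M : ℝ) / 16) ^ d * ((d : ℝ) * ((M : ℝ) ^ 2 / 8 * ((M : ℝ) ^ 4 / 1024) ^ (d - 1))) ^ 2 with hγlow
  have hγlow0 : 0 < γlow := by
    have hM0 : (0 : ℝ) < M := by exact_mod_cast (by omega : 0 < M)
    have hd0 : (0 : ℝ) < d := by exact_mod_cast (by omega : 0 < d)
    positivity
  have hγ₁low : γlow ≤ γ₁ := gram_lapRho_lower hM hψ hρ hLρ
  have hγ₁0 : 0 < γ₁ := lt_of_lt_of_le hγlow0 hγ₁low
  have hC₁le : ∀ w, ‖C₁ w‖ ≤ (M : ℝ) ^ d * Λ * B / γ₁ := by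
    intro w
    have e := hC₁F w
    have : C₁ w = γ₁⁻¹ • (γ₁ • C₁ w) := by rw [smul_smul, inv_mul_cancel₀ hγ₁0.ne', one_smul]
    rw [this, e, norm_smul, Real.norm_eq_abs, abs_of_pos (inv_pos.mpr hγ₁0), div_eq_inv_mul]
    refine mul_le_mul_of_nonneg_left ?_ (inv_pos.mpr hγ₁0).le
    split_ifs
    · rw [norm_zero]; positivity
    · exact hSFle w
  -- (5) the bound
  intro y
  have hgy : g y = h 0 + ΦL₁ y := by rw [← hconst y]; simp only [hh, sub_add_cancel]
  have hΦL₁le : ‖ΦL₁ y‖ ≤ Λ * ((M : ℝ) ^ d * Λ * B / γ₁) := norm_profS_le M s hLρΛ hC₁le y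
  have hratio : Λ * ((M : ℝ) ^ d * Λ * B / γ₁) ≤ 576 * (16 : ℝ) ^ d * (64 : ℝ) ^ (2 * (d - 1)) * B := by
    have e := ratio_const hd hM1
    rw [← hΛ, ← hγlow] at e
    have h1 : Λ * ((M : ℝ) ^ d * Λ * B / γ₁) = Λ ^ 2 * (M : ℝ) ^ d / γ₁ * B := by ring
    rw [h1, e]
    have h2 : 576 * (16 : ℝ) ^ d * (64 : ℝ) ^ (2 * (d - 1)) * γlow / γ₁ ≤ 576 * (16 : ℝ) ^ d * (64 : ℝ) ^ (2 * (d - 1)) := by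
      rw [div_le_iff₀ hγ₁0]
      exact mul_le_mul_of_nonneg_left hγ₁low (by positivity)
    exact mul_le_mul_of_nonneg_right h2 hB0
  have hΔeq : Δ lam₁ y = g y - F y := by simp only [hg, add_sub_cancel_left]
  rw [hΔeq, hgy]
  calc ‖h 0 + ΦL₁ y - F y‖ ≤ ‖h 0‖ + ‖ΦL₁ y‖ + ‖F y‖ := by
        calc ‖h 0 + ΦL₁ y - F y‖ ≤ ‖h 0 + ΦL₁ y‖ + ‖F y‖ := norm_sub_le _ _
          _ ≤ ‖h 0‖ + ‖ΦL₁ y‖ + ‖F y‖ := by linarith [norm_add_le (h 0) (ΦL₁ y)]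
    _ ≤ B + 576 * (16 : ℝ) ^ d * (64 : ℝ) ^ (2 * (d - 1)) * B + B := by linarith [hK, hΦL₁le.trans hratio, hB y]
    _ = (2 + 576 * (16 : ℝ) ^ d * (64 : ℝ) ^ (2 * (d - 1))) * B := by ring

end

end Summit.QuantumFields.BalabanUV.T4Continuum.NE7CornerBumpFlatGalerkinSup
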